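import Mathlib
import Summits.AtomisticToContinuum.FouriersLaw.Theorems.ParityLiouvilleSeedCesaroUpgradeGrowth
import HarnessLib

/-!
# Cesàro upgrade, helper 5: time invariance extends to polynomially growing local observables

Support file for item `stmt-AtomisticToContinuum-13981` (`ParityLiouvilleSeed.CesaroUpgrade`).

`IsTimeInvariant P ν` asserts `∫ 𝒜f dν = 0` only for BOUNDED local `C¹` functions with bounded
derivative. The site energy `e_x` (whose `𝒜e_x = j_{x-1} - j_x` is the continuity equation
behind bond independence of the mean current) is an unbounded polynomial. This file proves the
cut-off lemma `integral_liouvilleZ_comp_eq_zero_of_growth`: for the pinned chain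
`pinnedChain ω₂ lam β γ` (any real parameters) and a probability measure `ν` that is time
invariant and has site-uniform moments of every order, `∫ 𝒜(g ∘ box_{a,n}) dν = 0` (with
integrability) for every `C¹` profile `g` whose values and partial derivatives along the box
grow at most like `K (1 + ‖box_R σ‖)^d`.

Proof: multiply `g` by the rescaled smooth bump `χ((N+1)⁻¹ y)` (`χ = 1` on the unit ball,
supported in the ball of radius `2`; Mathlib `ContDiffBump` on the finite-dimensional box
space); the cut-off profiles are local test functions, `𝒜` of them converges pointwise to
`𝒜(g ∘ box)` (the bump is eventually `1` near each point) and is dominated by an integrable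
polynomial weight (the rescaled bump has derivative bounded uniformly in `N`); dominated
convergence.

No definitions.
-/

noncomputable section

namespace Summit.AtomisticToContinuum.FouriersLaw.Theorems.CesaroUpgrade

open MeasureTheory Filter Topology Set
open Literature.MathematicalPhysics.KineticTheory.HeatConduction

/-- Box coordinates `a + i`, `i ≤ n`, lie in the centred box `{-R, …, R}` with a margin when
`|a| + 1 ≤ R` and `|a + n| + 1 ≤ R`. [folklore] -/
theorem abs_add_fin_add_one_le {a : ℤ} {n R : ℕ} (ha : |a| + 1 ≤ R) (han : |a + n| + 1 ≤ R)
    (i : Fin (n + 1)) : |a + (i : ℤ)| + 1 ≤ R := by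
  have hi := i.isLt
  obtain ⟨ha1, ha2⟩ := abs_le.mp (show |a| ≤ (R : ℤ) - 1 by linarith)
  obtain ⟨hb1, hb2⟩ := abs_le.mp (show |a + (n : ℤ)| ≤ (R : ℤ) - 1 by linarith)
  have : |a + (i : ℤ)| ≤ (R : ℤ) - 1 := abs_le.mpr ⟨by omega, by omega⟩
  linarith

/-- The box `{a, …, a+n}` is dominated by a centred box containing it:
`‖box_{a,n} σ‖ ≤ ‖box_R σ‖`. [folklore] -/
theorem norm_boxRestrictAt_le {a : ℤ} {n R : ℕ} (ha : |a| + 1 ≤ R) (han : |a + n| + 1 ≤ R)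
    (σ : ChainConfig) : ‖boxRestrictAt a n σ‖ ≤ ‖boxRestrict R σ‖ := by
  refine (pi_norm_le_iff_of_nonneg (norm_nonneg _)).mpr fun i => ?_
  rw [boxRestrictAt_apply]
  have := abs_add_fin_add_one_le ha han i
  exact norm_apply_le_norm_boxRestrict (by linarith) σ

/-- Unit coordinate vectors of the box space have norm at most one. [folklore] -/
theorem norm_single_le_one {n : ℕ} (i : Fin (n + 1)) (v : ℝ × ℝ) (hv : ‖v‖ ≤ 1) :
    ‖(Pi.single i v : Fin (n + 1) → ℝ × ℝ)‖ ≤ 1 := by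
  rw [Pi.norm_single]; exact hv

section PinnedChain

variable (ω₂ lam β γ : ℝ)

/-- **Time invariance extends to polynomially growing local observables (cut-off lemma).** For
the pinned chain and a time-invariant probability measure with site-uniform moments of all
orders, `∫ 𝒜(g ∘ box_{a,n}) dν = 0` for every `C¹` profile `g` with
`|g|, |∂_{q_i} g|, |∂_{p_i} g| ≤ K (1 + ‖box_R σ‖)^d` along the box, `{a-1, …, a+n+1} ⊆ {-R, …, R}`.
[folklore] -/
theorem integral_liouvilleZ_comp_eq_zero_of_growth {ν : Measure ChainConfig} [IsProbabilityMeasure ν]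
    (hTI : IsTimeInvariant (pinnedChain ω₂ lam β γ) ν)
    (hmom : ∀ m : ℕ, ∃ C : ℝ, ∀ x : ℤ,
      Integrable (fun σ : ChainConfig => |(σ x).1| ^ m + |(σ x).2| ^ m) ν ∧
        ∫ σ, (|(σ x).1| ^ m + |(σ x).2| ^ m) ∂ν ≤ C)
    {a : ℤ} {n R d : ℕ} (ha : |a| + 1 ≤ R) (han : |a + n| + 1 ≤ R)
    {g : (Fin (n + 1) → ℝ × ℝ) → ℝ} (hg : ContDiff ℝ 1 g) {K : ℝ}
    (hgb : ∀ σ : ChainConfig, |g (boxRestrictAt a n σ)| ≤ K * (1 + ‖boxRestrict R σ‖) ^ d)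
    (hgq : ∀ (σ : ChainConfig) (z : ℤ), a ≤ z → z ≤ a + n →
      |partialQZ z (g ∘ boxRestrictAt a n) σ| ≤ K * (1 + ‖boxRestrict R σ‖) ^ d)
    (hgp : ∀ (σ : ChainConfig) (z : ℤ), a ≤ z → z ≤ a + n →
      |partialPZ z (g ∘ boxRestrictAt a n) σ| ≤ K * (1 + ‖boxRestrict R σ‖) ^ d) :
    Integrable (liouvilleZ (pinnedChain ω₂ lam β γ) (g ∘ boxRestrictAt a n)) ν ∧
      ∫ σ, liouvilleZ (pinnedChain ω₂ lam β γ) (g ∘ boxRestrictAt a n) σ ∂ν = 0 := by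
  set P := pinnedChain ω₂ lam β γ with hP
  have hK : 0 ≤ K := by
    have h := hgb (fun _ => (0, 0))
    have h1 : (0 : ℝ) < (1 + ‖boxRestrict R (fun _ : ℤ => ((0 : ℝ), (0 : ℝ)))‖) ^ d := by positivity
    nlinarith [abs_nonneg (g (boxRestrictAt a n fun _ => (0, 0)))]
  -- the bump and its rescalings
  let χ : ContDiffBump (0 : Fin (n + 1) → ℝ × ℝ) := default
  have hχIn : χ.rIn = 1 := rfl
  have hχOut : χ.rOut = 2 := rfl
  have hχdiff : ContDiff ℝ 1 χ := χ.contDiff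
  have hχd : Differentiable ℝ χ := hχdiff.differentiable one_ne_zero
  obtain ⟨M₁, hM₁⟩ : ∃ M₁, ∀ y, ‖fderiv ℝ χ y‖ ≤ M₁ :=
    (hχdiff.continuous_fderiv one_ne_zero).bounded_above_of_compact_support
      (χ.hasCompactSupport.fderiv (𝕜 := ℝ))
  have hM₁0 : 0 ≤ M₁ := (norm_nonneg _).trans (hM₁ 0)
  set c : ℕ → ℝ := fun N => ((N : ℝ) + 1)⁻¹ with hc
  have hcpos : ∀ N, 0 < c N := fun N => by positivity
  have hcle : ∀ N, c N ≤ 1 := fun N => inv_le_one_of_one_le₀ (by linarith [Nat.cast_nonneg (α := ℝ) N])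
  set χs : ℕ → (Fin (n + 1) → ℝ × ℝ) → ℝ := fun N y => χ (c N • y) with hχs
  have hχs_has : ∀ N y, HasFDerivAt (χs N)
      ((fderiv ℝ χ (c N • y)).comp (c N • ContinuousLinearMap.id ℝ (Fin (n + 1) → ℝ × ℝ))) y :=
    fun N y => (hχd _).hasFDerivAt.comp y ((hasFDerivAt_id y).const_smul (c N))
  have hχs_diff : ∀ N, Differentiable ℝ (χs N) := fun N y => (hχs_has N y).differentiableAt
  have hχs_contDiff : ∀ N, ContDiff ℝ 1 (χs N) := fun N =>
    hχdiff.comp (contDiff_id.const_smul (c N))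
  have hχs_fderiv : ∀ N y, ‖fderiv ℝ (χs N) y‖ ≤ M₁ := fun N y => by
    rw [(hχs_has N y).fderiv]
    calc _ ≤ ‖fderiv ℝ χ (c N • y)‖ * ‖c N • ContinuousLinearMap.id ℝ (Fin (n + 1) → ℝ × ℝ)‖ :=
          ContinuousLinearMap.opNorm_comp_le _ _
      _ ≤ M₁ * 1 := by
          refine mul_le_mul (hM₁ _) ?_ (norm_nonneg _) hM₁0
          rw [norm_smul, Real.norm_eq_abs, abs_of_pos (hcpos N)]
          calc c N * ‖ContinuousLinearMap.id ℝ (Fin (n + 1) → ℝ × ℝ)‖ ≤ 1 * 1 :=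
                mul_le_mul (hcle N) ContinuousLinearMap.norm_id_le (norm_nonneg _) zero_le_one
            _ = 1 := one_mul _
      _ = M₁ := mul_one _
  have hχs_abs : ∀ N y, |χs N y| ≤ 1 := fun N y => by
    rw [abs_of_nonneg (χ.nonneg' _)]; exact χ.le_one
  have hχs_one : ∀ y : Fin (n + 1) → ℝ × ℝ, ∀ᶠ N in atTop, χs N =ᶠ[𝓝 y] fun _ => 1 := by
    intro y
    filter_upwards [eventually_gt_atTop ⌈‖y‖⌉₊] with N hN
    have hNy : ‖y‖ < (N : ℝ) + 1 := by
      have := Nat.lt_of_ceil_lt hN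
      linarith
    have hlt : ‖c N • y‖ < 1 := by
      rw [norm_smul, Real.norm_eq_abs, abs_of_pos (hcpos N), hc]
      rw [inv_mul_lt_iff₀ (by positivity)]
      linarith
    have h1 : (χ : (Fin (n + 1) → ℝ × ℝ) → ℝ) =ᶠ[𝓝 (c N • y)] 1 :=
      χ.eventuallyEq_one_of_mem_ball (by rwa [mem_ball_zero_iff, hχIn])
    exact h1.comp_tendsto (continuous_const_smul (c N)).continuousAt
  have hχs_zero : ∀ (N : ℕ) (y : Fin (n + 1) → ℝ × ℝ), 2 * ((N : ℝ) + 1) ≤ ‖y‖ → χs N y = 0 :=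
      fun N y hy => by
    refine χ.zero_of_le_dist ?_
    rw [dist_zero_right, norm_smul, Real.norm_eq_abs, abs_of_pos (hcpos N), hχOut, hc]
    rw [le_inv_mul_iff₀ (by positivity)]
    linarith
  -- the cut-off profiles
  set gN : ℕ → (Fin (n + 1) → ℝ × ℝ) → ℝ := fun N y => χs N y * g y with hgN
  have hg_diff : Differentiable ℝ g := hg.differentiable one_ne_zero
  have hgq' : ∀ (σ : ChainConfig) (i : Fin (n + 1)),
      |fderiv ℝ g (boxRestrictAt a n σ) (Pi.single i (1, 0))| ≤ K * (1 + ‖boxRestrict R σ‖) ^ d := by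
    intro σ i
    have hi := i.isLt
    rw [← partialQZ_comp_boxRestrictAt_of_eq a n σ i (hg_diff _)]
    exact hgq σ (a + i) (by simp) (by omega)
  have hgp' : ∀ (σ : ChainConfig) (i : Fin (n + 1)),
      |fderiv ℝ g (boxRestrictAt a n σ) (Pi.single i (0, 1))| ≤ K * (1 + ‖boxRestrict R σ‖) ^ d := by
    intro σ i
    have hi := i.isLt
    rw [← partialPZ_comp_boxRestrictAt_of_eq a n σ i (hg_diff _)]
    exact hgp σ (a + i) (by simp) (by omega)
  have hgN_contDiff : ∀ N, ContDiff ℝ 1 (gN N) := fun N => (hχs_contDiff N).mul hg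
  have hgN_compact : ∀ N, HasCompactSupport (gN N) := fun N => by
    refine HasCompactSupport.intro (isCompact_closedBall (0 : Fin (n + 1) → ℝ × ℝ)
      (2 * ((N : ℝ) + 1))) fun y hy => ?_
    rw [mem_closedBall_zero_iff, not_le] at hy
    simp only [hgN, hχs_zero N y hy.le, zero_mul]
  have hgN_test : ∀ N, IsLocalTestFunction (gN N ∘ boxRestrictAt a n) := fun N => by
    obtain ⟨B, hB⟩ := (hgN_contDiff N).continuous.bounded_above_of_compact_support (hgN_compact N)
    obtain ⟨B', hB'⟩ := ((hgN_contDiff N).continuous_fderiv one_ne_zero).bounded_above_of_compact_support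
      ((hgN_compact N).fderiv (𝕜 := ℝ))
    exact isLocalTestFunction_comp_boxRestrictAt a n (hgN_contDiff N)
      ⟨B, fun y => by rw [← Real.norm_eq_abs]; exact hB y⟩ ⟨B', hB'⟩
  have hTI_N : ∀ N, Integrable (liouvilleZ P (gN N ∘ boxRestrictAt a n)) ν ∧
      ∫ σ, liouvilleZ P (gN N ∘ boxRestrictAt a n) σ ∂ν = 0 := fun N => hTI _ (hgN_test N)
  -- box formulas and the product rule
  have hbox : ∀ σ, liouvilleZ P (g ∘ boxRestrictAt a n) σ = ∑ i : Fin (n + 1),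
      ((σ (a + i)).2 * fderiv ℝ g (boxRestrictAt a n σ) (Pi.single i (1, 0)) +
        P.force σ (a + i) * fderiv ℝ g (boxRestrictAt a n σ) (Pi.single i (0, 1))) :=
    fun σ => liouvilleZ_comp_boxRestrictAt P a n σ (hg_diff _)
  have hboxN : ∀ N σ, liouvilleZ P (gN N ∘ boxRestrictAt a n) σ = ∑ i : Fin (n + 1),
      ((σ (a + i)).2 * fderiv ℝ (gN N) (boxRestrictAt a n σ) (Pi.single i (1, 0)) +
        P.force σ (a + i) * fderiv ℝ (gN N) (boxRestrictAt a n σ) (Pi.single i (0, 1))) :=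
    fun N σ => liouvilleZ_comp_boxRestrictAt P a n σ ((hgN_contDiff N).differentiable one_ne_zero _)
  have hfd : ∀ N y v, fderiv ℝ (gN N) y v =
      χs N y * fderiv ℝ g y v + g y * fderiv ℝ (χs N) y v := fun N y v => by
    simp only [hgN]
    rw [fderiv_fun_mul (hχs_diff N y) (hg_diff y)]
    rfl
  -- pointwise convergence
  have hptw : ∀ σ, Tendsto (fun N => liouvilleZ P (gN N ∘ boxRestrictAt a n) σ) atTop
      (𝓝 (liouvilleZ P (g ∘ boxRestrictAt a n) σ)) := by
    intro σ
    refine (tendsto_const_nhds (x := liouvilleZ P (g ∘ boxRestrictAt a n) σ)).congr' ?_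
    filter_upwards [hχs_one (boxRestrictAt a n σ)] with N hN
    have h1 : χs N (boxRestrictAt a n σ) = 1 := hN.eq_of_nhds
    have h2 : fderiv ℝ (χs N) (boxRestrictAt a n σ) = 0 := by
      rw [hN.fderiv_eq]; exact fderiv_const_apply _
    rw [hboxN, hbox]
    refine Finset.sum_congr rfl fun i _ => ?_
    rw [hfd, hfd, h1, h2]
    simp
  -- bounds on the directional derivatives of the cut-off profiles
  have hfd_le : ∀ N σ (v : Fin (n + 1) → ℝ × ℝ), ‖v‖ ≤ 1 →
      |fderiv ℝ g (boxRestrictAt a n σ) v| ≤ K * (1 + ‖boxRestrict R σ‖) ^ d →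
      |fderiv ℝ (gN N) (boxRestrictAt a n σ) v| ≤ K * (1 + M₁) * (1 + ‖boxRestrict R σ‖) ^ d := by
    intro N σ v hv hDg
    rw [hfd]
    have hS : 0 ≤ K * (1 + ‖boxRestrict R σ‖) ^ d := by positivity
    calc |χs N (boxRestrictAt a n σ) * fderiv ℝ g (boxRestrictAt a n σ) v +
          g (boxRestrictAt a n σ) * fderiv ℝ (χs N) (boxRestrictAt a n σ) v|
        ≤ |χs N (boxRestrictAt a n σ)| * |fderiv ℝ g (boxRestrictAt a n σ) v| +
          |g (boxRestrictAt a n σ)| * |fderiv ℝ (χs N) (boxRestrictAt a n σ) v| := by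
          rw [← abs_mul, ← abs_mul]; exact abs_add_le _ _
      _ ≤ 1 * (K * (1 + ‖boxRestrict R σ‖) ^ d) + K * (1 + ‖boxRestrict R σ‖) ^ d * (M₁ * 1) := by
          gcongr
          · exact hχs_abs N _
          · exact hgb σ
          · rw [← Real.norm_eq_abs]
            calc ‖fderiv ℝ (χs N) (boxRestrictAt a n σ) v‖
                ≤ ‖fderiv ℝ (χs N) (boxRestrictAt a n σ)‖ * ‖v‖ := ContinuousLinearMap.le_opNorm _ _
              _ ≤ M₁ * 1 := mul_le_mul (hχs_fderiv N _) hv (norm_nonneg _) hM₁0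
      _ = K * (1 + M₁) * (1 + ‖boxRestrict R σ‖) ^ d := by ring
  have hv1 : ∀ i : Fin (n + 1), ‖(Pi.single i ((1 : ℝ), (0 : ℝ)) : Fin (n + 1) → ℝ × ℝ)‖ ≤ 1 :=
    fun i => norm_single_le_one i _ (by simp [Prod.norm_def])
  have hv2 : ∀ i : Fin (n + 1), ‖(Pi.single i ((0 : ℝ), (1 : ℝ)) : Fin (n + 1) → ℝ × ℝ)‖ ≤ 1 :=
    fun i => norm_single_le_one i _ (by simp [Prod.norm_def])
  -- the dominating function
  set KF : ℝ := |ω₂| + |lam| + 4 + 16 * |β| with hKF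
  have hKF0 : 0 ≤ KF := by rw [hKF]; positivity
  set G : ChainConfig → ℝ := fun σ =>
    ((n : ℝ) + 1) * ((1 + KF) * (1 + ‖boxRestrict R σ‖) ^ 3) *
      (K * (1 + M₁) * (1 + ‖boxRestrict R σ‖) ^ d) with hG
  have hsite : ∀ (σ : ChainConfig) (i : Fin (n + 1)),
      |(σ (a + i)).2| + |P.force σ (a + i)| ≤ (1 + KF) * (1 + ‖boxRestrict R σ‖) ^ 3 := by
    intro σ i
    have hi := abs_add_fin_add_one_le ha han i
    have hp : |(σ (a + i)).2| ≤ ‖boxRestrict R σ‖ := abs_snd_le_norm_boxRestrict (by linarith) σ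
    have hF := abs_pinnedChain_force_le ω₂ lam β γ hi σ
    have h1 : (1 : ℝ) ≤ 1 + ‖boxRestrict R σ‖ := by linarith [norm_nonneg (boxRestrict R σ)]
    have h3 : 1 + ‖boxRestrict R σ‖ ≤ (1 + ‖boxRestrict R σ‖) ^ 3 := by
      calc 1 + ‖boxRestrict R σ‖ = (1 + ‖boxRestrict R σ‖) ^ 1 := (pow_one _).symm
        _ ≤ (1 + ‖boxRestrict R σ‖) ^ 3 := pow_le_pow_right₀ h1 (by norm_num)
    calc |(σ (a + i)).2| + |P.force σ (a + i)| ≤ (1 + ‖boxRestrict R σ‖) ^ 3 +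
          KF * (1 + ‖boxRestrict R σ‖) ^ 3 := add_le_add (by linarith) hF
      _ = (1 + KF) * (1 + ‖boxRestrict R σ‖) ^ 3 := by ring
  have hterm_le : ∀ (θ : (Fin (n + 1) → ℝ × ℝ) → ℝ) (B : ℝ) (σ : ChainConfig),
      (∀ i, |fderiv ℝ θ (boxRestrictAt a n σ) (Pi.single i (1, 0))| ≤ B * (1 + ‖boxRestrict R σ‖) ^ d) →
      (∀ i, |fderiv ℝ θ (boxRestrictAt a n σ) (Pi.single i (0, 1))| ≤ B * (1 + ‖boxRestrict R σ‖) ^ d) →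
      0 ≤ B →
      |∑ i : Fin (n + 1), ((σ (a + i)).2 * fderiv ℝ θ (boxRestrictAt a n σ) (Pi.single i (1, 0)) +
        P.force σ (a + i) * fderiv ℝ θ (boxRestrictAt a n σ) (Pi.single i (0, 1)))| ≤
      ((n : ℝ) + 1) * ((1 + KF) * (1 + ‖boxRestrict R σ‖) ^ 3) *
        (B * (1 + ‖boxRestrict R σ‖) ^ d) := by
    intro θ B σ hq hp hB
    refine (Finset.abs_sum_le_sum_abs _ _).trans ?_
    have hD : 0 ≤ B * (1 + ‖boxRestrict R σ‖) ^ d := by positivity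
    calc ∑ i : Fin (n + 1), |(σ (a + i)).2 * fderiv ℝ θ (boxRestrictAt a n σ) (Pi.single i (1, 0)) +
          P.force σ (a + i) * fderiv ℝ θ (boxRestrictAt a n σ) (Pi.single i (0, 1))|
        ≤ ∑ i : Fin (n + 1), (|(σ (a + i)).2| + |P.force σ (a + i)|) *
            (B * (1 + ‖boxRestrict R σ‖) ^ d) := by
          refine Finset.sum_le_sum fun i _ => ?_
          calc _ ≤ |(σ (a + i)).2| * |fderiv ℝ θ (boxRestrictAt a n σ) (Pi.single i (1, 0))| +
                |P.force σ (a + i)| * |fderiv ℝ θ (boxRestrictAt a n σ) (Pi.single i (0, 1))| := by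
                rw [← abs_mul, ← abs_mul]; exact abs_add_le _ _
            _ ≤ |(σ (a + i)).2| * (B * (1 + ‖boxRestrict R σ‖) ^ d) +
                |P.force σ (a + i)| * (B * (1 + ‖boxRestrict R σ‖) ^ d) := by
                gcongr
                · exact hq i
                · exact hp i
            _ = (|(σ (a + i)).2| + |P.force σ (a + i)|) * (B * (1 + ‖boxRestrict R σ‖) ^ d) := by
                ring
      _ ≤ ∑ _i : Fin (n + 1), ((1 + KF) * (1 + ‖boxRestrict R σ‖) ^ 3) *
            (B * (1 + ‖boxRestrict R σ‖) ^ d) := by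
          gcongr with i
          exact hsite σ i
      _ = _ := by
          rw [Finset.sum_const, Finset.card_univ, Fintype.card_fin, nsmul_eq_mul]
          push_cast
          ring
  have hdom : ∀ N σ, |liouvilleZ P (gN N ∘ boxRestrictAt a n) σ| ≤ G σ := fun N σ => by
    rw [hboxN]
    exact hterm_le (gN N) (K * (1 + M₁)) σ (fun i => hfd_le N σ _ (hv1 i) (hgq' σ i))
      (fun i => hfd_le N σ _ (hv2 i) (hgp' σ i)) (by positivity)
  have hdom0 : ∀ σ, |liouvilleZ P (g ∘ boxRestrictAt a n) σ| ≤ G σ := fun σ => by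
    rw [hbox]
    refine (hterm_le g K σ (hgq' σ) (hgp' σ) hK).trans ?_
    have hS : 0 ≤ (1 + ‖boxRestrict R σ‖) ^ d := by positivity
    have h1 : K * (1 + ‖boxRestrict R σ‖) ^ d ≤ K * (1 + M₁) * (1 + ‖boxRestrict R σ‖) ^ d := by
      have : K ≤ K * (1 + M₁) := by nlinarith
      exact mul_le_mul_of_nonneg_right this hS
    have hA : 0 ≤ ((n : ℝ) + 1) * ((1 + KF) * (1 + ‖boxRestrict R σ‖) ^ 3) :=
      mul_nonneg (by positivity) (mul_nonneg (by linarith) (by positivity))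
    exact mul_le_mul_of_nonneg_left h1 hA
  -- integrability of the dominating function
  have hG_growth : ∀ σ, |G σ| ≤ ((n : ℝ) + 1) * (1 + KF) * (K * (1 + M₁)) *
      (1 + ‖boxRestrict R σ‖) ^ (d + 3) := fun σ => by
    have hG0 : 0 ≤ G σ := by positivity
    rw [abs_of_nonneg hG0, hG]
    ring_nf
    rfl
  obtain ⟨Cm, hCm⟩ := hmom (d + 3)
  have hGint : Integrable G ν := by
    refine (integrable_of_abs_le_growth hG_growth ?_ hCm).1
    exact Continuous.aestronglyMeasurable (by simp only [hG]; fun_prop)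
  -- dominated convergence
  have hmeasN : ∀ N, AEStronglyMeasurable (liouvilleZ P (gN N ∘ boxRestrictAt a n)) ν := fun N =>
    ((hgN_test N).measurable_liouvilleZ P).aestronglyMeasurable
  have hlim := tendsto_integral_filter_of_dominated_convergence G (Eventually.of_forall hmeasN)
    (Eventually.of_forall fun N => ae_of_all _ fun σ => by
      rw [Real.norm_eq_abs]; exact hdom N σ) hGint (ae_of_all _ hptw)
  have h0 : (fun N => ∫ σ, liouvilleZ P (gN N ∘ boxRestrictAt a n) σ ∂ν) = fun _ => 0 :=
    funext fun N => (hTI_N N).2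
  rw [h0] at hlim
  have hmeas : AEStronglyMeasurable (liouvilleZ P (g ∘ boxRestrictAt a n)) ν :=
    aestronglyMeasurable_of_tendsto_ae atTop hmeasN (ae_of_all _ hptw)
  have hint : Integrable (liouvilleZ P (g ∘ boxRestrictAt a n)) ν :=
    hGint.mono' hmeas (ae_of_all _ fun σ => by rw [Real.norm_eq_abs]; exact hdom0 σ)
  exact ⟨hint, tendsto_nhds_unique hlim tendsto_const_nhds ▸ rfl⟩

end PinnedChain

end Summit.AtomisticToContinuum.FouriersLaw.Theorems.CesaroUpgrade

end
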